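import Mathlib
import HarnessLib
import Summits.Parity.GeneralizedHardyLittlewood.Theses.LiouvilleMAD
import Summits.Parity.GeneralizedHardyLittlewood.Theorems.DilatedTableChowla.Negative.DilatedTableChowlaBlocks
import Literature.Barriers.Parity.SiegelZeroDichotomy

/-!
# `DilatedChowla` (stmt-Parity-13319): the crux factored — base notation for the mirror line

Negative-lemma infrastructure for the crux `LiouvilleMAD.DilatedChowla` (route LiouvilleMAD,
rank-4 node; line `Sketch` = card `siegel-mirror`, lead seat), so that the line's stub files, the
disprover and later skeletons IMPORT one vocabulary instead of copying it.  The crux reads: for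
every `c ≠ 0` there are `κ > 0` and `C` with
`|Σ_{m ∈ (M,2M]} λ(mn+c) λ(mn'+c)| ≤ C · M^{1−κ}` for all `M` and all `1 ≤ n ≠ n' ≤ 2M`.

* The entry function `L z = λ(z.toNat)` and its elementary facts (`L_of_pos`, `L_sq_of_pos`,
  `L_mul_self_of_pos`, `L_nonpos_arg`, `abs_L_le_one`, `L_natCast`, `L_natCast_mul`,
  `card_modEq_Ioc_bounds`) are REUSED from the sibling crux's landed base file
  `Theorems/DilatedTableChowla/Negative/DilatedTableChowlaBlocks` (same sub-problem), not restated: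
  refer to them as `Summit.Parity.GeneralizedHardyLittlewood.Theorems.DilatedTableChowla.Negative.L` etc.
  (this file `open`s exactly those names).
* `S` (the pencil sum), `P` (the one-point progression sum), the READ-BACK `dilatedChowla_iff`
  (`Iff.rfl`), and the trivial bounds `abs_S_le`, `abs_P_le`, `S_self_le`, `S_self_eq`.
* `CoherentBias c` — the hypothesis of the Gram-positivity lever (a family of `V ≥ 4/b²`
  progressions `c mod qν`, `ν ≤ V`, whose one-point sums share a sign and have size `≥ bM`).
* `SiegelZerosAbove Q` — Siegel zeros (tree `Literature.Barriers.Parity.IsSiegelZero`) of quality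
  `≥ Q q` at arbitrarily large conductors; `siegelZerosAbove_imp_unbounded`: for `Q → ∞` along the
  conductors this is at least as strong as the tree's open `UnboundedSiegelZeros`.
* `DilatedChowlaAbove κ₀` — the crux with exponent floor `κ₀` (`dilatedChowla_iff_above_zero`),
  the shape in which exponent-tightness statements are recorded.
* `PowerDispersion` — the dispersion consequence (power-saving Barban–Davenport–Halberstam bound
  for `λ` in the single class `c mod m`, `m ≍ √x`).

Nothing here is a cited theorem; these are the crux's own objects (no Literature content).
-/

noncomputable section

namespace Summit.Parity.GeneralizedHardyLittlewood.Theorems.DilatedChowla.Negative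

open Summit.Parity.GeneralizedHardyLittlewood.Theses.LiouvilleMAD
open Summit.Parity.GeneralizedHardyLittlewood.Theorems.DilatedTableChowla.Negative
  (L toNat_ne_zero_of_pos L_of_pos L_sq_of_pos L_mul_self_of_pos L_nonpos_arg abs_L_le_one
    L_natCast L_natCast_mul card_modEq_Ioc_bounds)
open Literature.Barriers.Parity (IsSiegelZero UnboundedSiegelZeros)
open Finset

/-! ## §0 The crux, factored -/

/-- The pencil (two-point, dilated) sum of the crux:
`S c n n' M = Σ_{m ∈ (M,2M]} λ(mn+c) λ(mn'+c)`. -/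
def S (c : ℤ) (n n' M : ℕ) : ℝ :=
  ∑ m ∈ Ioc M (2 * M), L ((m : ℤ) * n + c) * L ((m : ℤ) * n' + c)

/-- The one-point progression sum `P c n M = Σ_{m ∈ (M,2M]} λ(mn+c)` (`λ` summed over the `M`
terms `u ≡ c (mod n)`, `u ∈ (nM+c, 2nM+c]`). -/
def P (c : ℤ) (n M : ℕ) : ℝ :=
  ∑ m ∈ Ioc M (2 * M), L ((m : ℤ) * n + c)

/-- READ-BACK: the crux is the uniform power bound on the pencil sums `S` (definitional). -/
theorem dilatedChowla_iff :
    DilatedChowla ↔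
      ∀ c : ℤ, c ≠ 0 → ∃ κ : ℝ, 0 < κ ∧ ∃ C : ℝ, ∀ M n n' : ℕ, 1 ≤ n → 1 ≤ n' → n ≠ n' →
        n ≤ 2 * M → n' ≤ 2 * M → |S c n n' M| ≤ C * (M : ℝ) ^ (1 - κ) :=
  Iff.rfl

/-- Trivial bound for the pencil sum: `|S c n n' M| ≤ M`. -/
theorem abs_S_le (c : ℤ) (n n' M : ℕ) : |S c n n' M| ≤ M := by
  unfold S
  calc |∑ m ∈ Ioc M (2 * M), L ((m : ℤ) * n + c) * L ((m : ℤ) * n' + c)|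
      ≤ ∑ m ∈ Ioc M (2 * M), |L ((m : ℤ) * n + c) * L ((m : ℤ) * n' + c)| :=
        abs_sum_le_sum_abs _ _
    _ ≤ ∑ _m ∈ Ioc M (2 * M), (1 : ℝ) := by
        refine sum_le_sum fun m _ => ?_
        rw [abs_mul]
        calc |L ((m : ℤ) * n + c)| * |L ((m : ℤ) * n' + c)| ≤ 1 * 1 :=
              mul_le_mul (abs_L_le_one _) (abs_L_le_one _) (abs_nonneg _) zero_le_one
          _ = 1 := one_mul 1
    _ = M := by simp; omega

/-- Trivial bound for the one-point sum: `|P c n M| ≤ M`. -/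
theorem abs_P_le (c : ℤ) (n M : ℕ) : |P c n M| ≤ M := by
  unfold P
  calc |∑ m ∈ Ioc M (2 * M), L ((m : ℤ) * n + c)|
      ≤ ∑ m ∈ Ioc M (2 * M), |L ((m : ℤ) * n + c)| := abs_sum_le_sum_abs _ _
    _ ≤ ∑ _m ∈ Ioc M (2 * M), (1 : ℝ) := sum_le_sum fun m _ => abs_L_le_one _
    _ = M := by simp; omega

/-- The diagonal pencil sum is at most `M`: `S c n n M ≤ M`. -/
theorem S_self_le (c : ℤ) (n M : ℕ) : S c n n M ≤ M :=
  le_trans (le_abs_self _) (abs_S_le c n n M)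

/-- No cancellation on the diagonal once the arguments are positive: if `M·n + c ≥ 0` (e.g.
`c ≥ 0`, or `M ≥ |c|` and `n ≥ 1`) then `S c n n M = M`. -/
theorem S_self_eq {c : ℤ} {n M : ℕ} (hn : 1 ≤ n) (h : 0 ≤ (M : ℤ) * n + c) :
    S c n n M = M := by
  unfold S
  calc ∑ m ∈ Ioc M (2 * M), L ((m : ℤ) * n + c) * L ((m : ℤ) * n + c)
      = ∑ _m ∈ Ioc M (2 * M), (1 : ℝ) := by
        refine sum_congr rfl fun m hm => ?_
        rw [mem_Ioc] at hm
        apply L_mul_self_of_pos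
        have hm1 : (M : ℤ) + 1 ≤ m := by exact_mod_cast hm.1
        have hn' : (1 : ℤ) ≤ n := by exact_mod_cast hn
        nlinarith
    _ = M := by simp; omega

/-! ## §1 The hypothesis of the Gram-positivity lever -/

/-- **Coherent class bias at shift `c`**: for every `κ > 0` and `C` there are a scale `M`, a modulus
`q ≥ 1`, a family size `V ≥ 1` with `qV ≤ 2M`, a bias `b > 0` with `b²V ≥ 4` and `V·C ≤ M^κ`, and a
common sign `σ = ±1`, such that every one-point sum along the dilations `qν`, `1 ≤ ν ≤ V`, satisfies
`σ · P c (qν) M ≥ b·M`.  (Gram positivity in the dilation variable turns this into `¬ DilatedChowla`: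
file `DilatedChowlaGram`.) -/
def CoherentBias (c : ℤ) : Prop :=
  ∀ κ : ℝ, 0 < κ → ∀ C : ℝ, ∃ M q V : ℕ, ∃ b σ : ℝ, (σ = 1 ∨ σ = -1) ∧
    1 ≤ q ∧ 1 ≤ V ∧ q * V ≤ 2 * M ∧ 0 < b ∧ 4 ≤ b ^ 2 * V ∧ (V : ℝ) * C ≤ (M : ℝ) ^ κ ∧
    ∀ ν : ℕ, 1 ≤ ν → ν ≤ V → b * M ≤ σ * P c (q * ν) M

/-! ## §2 Siegel zeros above a quality threshold -/

/-- **Siegel zeros of quality at least `Q q` occur at arbitrarily large conductors `q`**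
(`IsSiegelZero χ η`: `χ mod q` primitive quadratic, `η ≥ 10`, `L(1 − 1/(η log q), χ) = 0`;
Tao–Teräväinen 2021 Definition 1.4, tree `Literature.Barriers.Parity.IsSiegelZero`).  Its negation is
a zero-free interval `[1 − 1/(Q(q) log q), 1)` for the real zeros of primitive quadratic characters
at all large conductors. -/
def SiegelZerosAbove (Q : ℕ → ℝ) : Prop :=
  ∀ q₀ : ℕ, ∃ (q : ℕ) (_ : NeZero q) (χ : DirichletCharacter ℂ q) (η : ℝ),
    q₀ ≤ q ∧ Q q ≤ η ∧ IsSiegelZero χ η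

/-- Monotonicity in the threshold: zeros above `Q` are zeros above any `Q' ≤ Q`. -/
theorem SiegelZerosAbove.mono {Q Q' : ℕ → ℝ} (hQ : ∀ q, Q' q ≤ Q q) (h : SiegelZerosAbove Q) :
    SiegelZerosAbove Q' := by
  intro q₀
  obtain ⟨q, hq, χ, η, hq₀, hQq, hz⟩ := h q₀
  exact ⟨q, hq, χ, η, hq₀, le_trans (hQ q) hQq, hz⟩

/-- If `Q q → ∞` along the conductors (`∀ η₀ ∃ q₁ ∀ q ≥ q₁, η₀ ≤ Q q`), Siegel zeros above `Q` at
arbitrarily large conductors give the tree's open hypothesis `UnboundedSiegelZeros` (zeros of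
unbounded quality); contrapositively `¬ UnboundedSiegelZeros → ¬ SiegelZerosAbove Q`. -/
theorem siegelZerosAbove_imp_unbounded {Q : ℕ → ℝ}
    (hQ : ∀ η₀ : ℝ, ∃ q₁ : ℕ, ∀ q : ℕ, q₁ ≤ q → η₀ ≤ Q q) (h : SiegelZerosAbove Q) :
    UnboundedSiegelZeros := by
  intro η₀ q₀
  obtain ⟨q₁, hq₁⟩ := hQ η₀
  obtain ⟨q, hq, χ, η, hq₀', hQq, hz⟩ := h (max q₀ q₁)
  exact ⟨q, hq, χ, η, le_trans (le_max_left _ _) hq₀',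
    le_trans (hq₁ q (le_trans (le_max_right _ _) hq₀')) hQq, hz⟩

/-! ## §3 The crux with an exponent floor (shape of the tightness statements) -/

/-- The crux with exponent floor `κ₀` in place of `0`: for every `c ≠ 0` some exponent `κ > κ₀`
works. -/
def DilatedChowlaAbove (κ₀ : ℝ) : Prop :=
  ∀ c : ℤ, c ≠ 0 → ∃ κ : ℝ, κ₀ < κ ∧ ∃ C : ℝ, ∀ M n n' : ℕ, 1 ≤ n → 1 ≤ n' → n ≠ n' →
    n ≤ 2 * M → n' ≤ 2 * M → |S c n n' M| ≤ C * (M : ℝ) ^ (1 - κ)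

/-- READ-BACK: the crux is the case `κ₀ = 0` (definitional). -/
theorem dilatedChowla_iff_above_zero : DilatedChowla ↔ DilatedChowlaAbove 0 := Iff.rfl

/-- Monotonicity: a larger floor is a stronger statement. -/
theorem DilatedChowlaAbove.mono {κ₀ κ₁ : ℝ} (hle : κ₀ ≤ κ₁) (h : DilatedChowlaAbove κ₁) :
    DilatedChowlaAbove κ₀ := by
  intro c hc
  obtain ⟨κ, hκ, C, hC⟩ := h c hc
  exact ⟨κ, lt_of_le_of_lt hle hκ, C, hC⟩

/-! ## §4 The dispersion consequence (shape) -/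

/-- **Power dispersion at shift `c`**: `Σ_{m∈(M,2M]} (Σ_{1≤n≤2M} λ(mn+c))² ≤ 2M² + C·M^{3−κ}` for
some `κ > 0`, `C` and all `M` — by Linnik's identity the left side is `Σ_{n,n'≤2M} S c n n' M`,
random size `2M²` (a power-saving Barban–Davenport–Halberstam-type bound for `λ` in the single
class `c mod m` over moduli `m ≍ √x` with segments of length `≍ √x`, `x = 4M²`). -/
def PowerDispersion : Prop :=
  ∀ c : ℤ, c ≠ 0 → ∃ κ : ℝ, 0 < κ ∧ ∃ C : ℝ, ∀ M : ℕ,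
    ∑ m ∈ Ioc M (2 * M), (∑ n ∈ Icc 1 (2 * M), L ((m : ℤ) * n + c)) ^ 2
      ≤ 2 * (M : ℝ) ^ 2 + C * (M : ℝ) ^ (3 - κ)

end Summit.Parity.GeneralizedHardyLittlewood.Theorems.DilatedChowla.Negative

end
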